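import Literature.Computation.Certificates.PatakiRankBoundBlocks

/-!
# Rank reduction ("purification") in block semidefinite programs: a feasible point whose ranks exceed the
# Pataki budget can be moved, with ALL constraint values unchanged, to a feasible point of smaller total rank;
# hence every nonempty block spectrahedron contains a point with `Σ_ρ t(rank X_ρ) ≤ m`

Source: G. Pataki, *On the rank of extreme matrices in semidefinite programs and the multiplicity of optimal
eigenvalues*, Math. Oper. Res. 23 (1998) 339–358 [Pataki1998], §2: the proof of Thm 2.1 (1)/Thm 2.2
(pp. 343–344, eqs. (2.3)–(2.6)) is CONSTRUCTIVE — if `Σ_j t(r_j) > m` the reduced homogeneous system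
`Σ_j A_ij • Q_jΔ_jQ_jᵀ = 0` has a nonzero symmetric solution, the whole line `X_j(s) = Q_j(Λ_j + sΔ_j)Q_jᵀ`
satisfies the equality constraints, and moving along it until a block `Λ_j + sΔ_j` reaches the boundary of
the positive semidefinite cone produces a feasible point of strictly smaller rank; iterating gives a feasible
(and, if the objective is listed among the rows, equally good) point obeying the bound. This is the rank
reduction / "purification" procedure that accompanies the Barvinok–Pataki bound in the literature
(Pataki 1998 §2; Burer–Monteiro 2003 §3 Thm 1 "an optimal solution with `r(r+1)/2 ≤ m`").
[cite: Pataki1998, §2 proof of Thm. 2.1, eqs. (2.3)–(2.6)] [cite: BurerMonteiro2003, §3 Thm. 1 (p. 333)]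

Statements (block standard form of `PatakiRankBoundBlocks`: `blockFeasible A c = {S : S_ρ ⪰ 0, Σ_ρ tr(A_iρ S_ρ) = c_i}`):
* `line_mem` — moving along a kernel direction of the reduced constraint map keeps every constraint value;
* `exists_boundary_step` — for `Λ_ρ ≻ 0` and symmetric `Δ` not all positive semidefinite there is `s* > 0` with
  all `Λ_ρ + s*Δ_ρ ⪰ 0` and some block `Λ_ρ₁ + s*Δ_ρ₁` singular (NOT positive definite);
* (private) `rank_lt_of_posSemidef_of_not_posDef` — a singular positive semidefinite `r × r` matrix has rank `< r`;
* **`exists_mem_sum_rank_lt_of_card_lt_sum_tri`** — if `S` is feasible and `|κ| < Σ_ρ t(rank S_ρ)` then some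
  feasible `S'` (same `c`, i.e. the same value of EVERY listed linear functional) has `Σ_ρ rank S'_ρ < Σ_ρ rank S_ρ`;
* **`exists_mem_sum_tri_rank_le_card`** — every nonempty `blockFeasible A c` contains a point with
  `Σ_ρ t(rank S_ρ) ≤ |κ|` (no compactness, no objective, no extreme points needed).

Use (cell hubbard-algo, p1 TARGET Prop I "PURIFY"): list the objective `C` as an extra row (so `|κ| = f + 1` and the
value is preserved) and apply the theorem to any optimal multiplier — an optimal one with `Σ_ρ t(r_ρ) ≤ f + 1`
exists, reached by finitely many boundary steps. Everything is PROVED; no definition, no named fact.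
NOT HERE: the choice of the step by an eigenvalue formula (`s* = 1/λ_max(−Λ^{−1/2}ΔΛ^{−1/2})`) — we take the
supremum of the feasible segment instead, which is the same point.
-/

noncomputable section

namespace Literature.Computation.Certificates.SDPRankReduction

open Matrix Finset
open PatakiRankBound (tri UpperPair card_upperPair symOf symOfLin symOfLin_apply symOf_injective
  isHermitian_symOf exists_posDef_add_sub_smul)
open PatakiRankBoundBlocks (blockFeasible exists_rank_factorization exists_uniform_eps blockConstraintMap)

variable {ι : Type*} [Fintype ι]
variable {nρ : ι → Type*} [∀ ρ, Fintype (nρ ρ)]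
variable {κ : Type*}

/-! ## §1 The feasible line through a kernel direction -/

omit [Fintype ι] in
/-- `V M Vᵀ ⪰ 0` for `M ⪰ 0`. [folklore] -/
private theorem posSemidef_conj {ρ : ι} {r : ℕ} (V : Matrix (nρ ρ) (Fin r) ℝ)
    {M : Matrix (Fin r) (Fin r) ℝ} (hM : M.PosSemidef) : (V * M * Vᵀ).PosSemidef := by
  simpa [conjTranspose_eq_transpose_of_trivial] using hM.mul_mul_conjTranspose_same V

/-- The LINE through a feasible point along a kernel direction: if `S_ρ = V_ρ Λ_ρ V_ρᵀ` is feasible and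
`Δ` solves `Σ_ρ tr(A_iρ V_ρ Δ_ρ V_ρᵀ) = 0` for all `i`, then for every `s` with all `Λ_ρ + sΔ_ρ ⪰ 0` the point
`(V_ρ (Λ_ρ + sΔ_ρ) V_ρᵀ)_ρ` is feasible with the SAME right-hand sides `c`.
[cite: Pataki1998, §2 proof of Thm. 2.1, eqs. (2.5)–(2.6)] -/
theorem line_mem {A : κ → ∀ ρ, Matrix (nρ ρ) (nρ ρ) ℝ} {c : κ → ℝ} {r : ι → ℕ}
    {V : ∀ ρ, Matrix (nρ ρ) (Fin (r ρ)) ℝ} {Λ Δ : ∀ ρ, Matrix (Fin (r ρ)) (Fin (r ρ)) ℝ}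
    {S : ∀ ρ, Matrix (nρ ρ) (nρ ρ) ℝ} (hS : S ∈ blockFeasible A c) (hfac : ∀ ρ, S ρ = V ρ * Λ ρ * (V ρ)ᵀ)
    (hker : ∀ i, ∑ ρ, (A i ρ * (V ρ * Δ ρ * (V ρ)ᵀ)).trace = 0) {s : ℝ}
    (hpsd : ∀ ρ, (Λ ρ + s • Δ ρ).PosSemidef) :
    (fun ρ => V ρ * (Λ ρ + s • Δ ρ) * (V ρ)ᵀ) ∈ blockFeasible A c := by
  refine ⟨fun ρ => posSemidef_conj (V ρ) (hpsd ρ), fun i => ?_⟩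
  have h1 : ∀ ρ, (A i ρ * (V ρ * (Λ ρ + s • Δ ρ) * (V ρ)ᵀ)).trace
      = (A i ρ * S ρ).trace + s * (A i ρ * (V ρ * Δ ρ * (V ρ)ᵀ)).trace := by
    intro ρ
    rw [hfac ρ, Matrix.mul_add, Matrix.add_mul, Matrix.mul_smul, Matrix.smul_mul, Matrix.mul_add,
      trace_add, Matrix.mul_smul, trace_smul, smul_eq_mul]
  show ∑ ρ, (A i ρ * (V ρ * (Λ ρ + s • Δ ρ) * (V ρ)ᵀ)).trace = c i
  simp only [h1, Finset.sum_add_distrib, ← Finset.mul_sum, hker i, mul_zero, add_zero]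
  exact hS.2 i

/-! ## §2 The boundary step along the line -/

section Boundary

variable {p : Type*} [Fintype p]

/-- The quadratic form of `Λ + sΔ` is affine in `s`. [folklore] -/
private theorem quad_add_smul (Λ Δ : Matrix p p ℝ) (s : ℝ) (x : p → ℝ) :
    star x ⬝ᵥ ((Λ + s • Δ) *ᵥ x) = star x ⬝ᵥ (Λ *ᵥ x) + s * (star x ⬝ᵥ (Δ *ᵥ x)) := by
  rw [add_mulVec, smul_mulVec, dotProduct_add, dotProduct_smul, smul_eq_mul]

omit [Fintype p] in
/-- `Λ + sΔ` is symmetric for symmetric `Λ, Δ`. [folklore] -/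
private theorem isHermitian_add_smul {Λ Δ : Matrix p p ℝ} (hΛ : Λ.IsHermitian) (hΔ : Δ.IsHermitian)
    (s : ℝ) : (Λ + s • Δ).IsHermitian :=
  hΛ.add (hΔ.smul (IsSelfAdjoint.all s))

/-- If a symmetric `Δ` is NOT positive semidefinite, some vector has a negative quadratic form. [folklore] -/
private theorem exists_quad_neg {Δ : Matrix p p ℝ} (hΔ : Δ.IsHermitian) (h : ¬ Δ.PosSemidef) :
    ∃ x : p → ℝ, star x ⬝ᵥ (Δ *ᵥ x) < 0 := by
  by_contra hcon
  push Not at hcon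
  exact h (PosSemidef.of_dotProduct_mulVec_nonneg hΔ hcon)

end Boundary

/-- THE BOUNDARY STEP, all blocks at once: if every `Λ_ρ ≻ 0`, every `Δ_ρ` is symmetric and NOT all `Δ_ρ`
are positive semidefinite, then for some `s* > 0` all `Λ_ρ + s*Δ_ρ` are positive semidefinite and at least
one of them is singular (not positive definite) — the first point where the line leaves the interior of the
cone ("choose `ε` such that `Λ + εΔ ⪰ 0` is on the boundary", the rank-reducing choice in Pataki's proof).
[cite: Pataki1998, §2 proof of Thm. 2.1, eqs. (2.5)–(2.6)] -/
theorem exists_boundary_step {r : ι → ℕ} {Λ Δ : ∀ ρ, Matrix (Fin (r ρ)) (Fin (r ρ)) ℝ}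
    (hΛ : ∀ ρ, (Λ ρ).PosDef) (hΔ : ∀ ρ, (Δ ρ).IsHermitian) (hnot : ¬ ∀ ρ, (Δ ρ).PosSemidef) :
    ∃ s : ℝ, 0 < s ∧ (∀ ρ, (Λ ρ + s • Δ ρ).PosSemidef) ∧ ∃ ρ₁, ¬ (Λ ρ₁ + s • Δ ρ₁).PosDef := by
  -- the feasible parameter set along the ray
  set T : Set ℝ := {s | 0 ≤ s ∧ ∀ ρ, (Λ ρ + s • Δ ρ).PosSemidef} with hT
  have h0T : (0 : ℝ) ∈ T := ⟨le_rfl, fun ρ => by simpa using (hΛ ρ).posSemidef⟩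
  have hTne : T.Nonempty := ⟨0, h0T⟩
  -- a block `ρ₀` and a vector `x₀` with negative `Δ`-form bound `T`
  obtain ⟨ρ₀, hρ₀⟩ := not_forall.mp hnot
  obtain ⟨x₀, hx₀⟩ := exists_quad_neg (hΔ ρ₀) hρ₀
  set a₀ : ℝ := star x₀ ⬝ᵥ (Λ ρ₀ *ᵥ x₀) with ha₀
  set b₀ : ℝ := star x₀ ⬝ᵥ (Δ ρ₀ *ᵥ x₀) with hb₀
  have ha₀nn : 0 ≤ a₀ := (hΛ ρ₀).posSemidef.dotProduct_mulVec_nonneg x₀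
  have hbdd : BddAbove T := by
    refine ⟨-a₀ / b₀, fun s hs => ?_⟩
    have hq : 0 ≤ a₀ + s * b₀ := by
      have := (hs.2 ρ₀).dotProduct_mulVec_nonneg x₀
      rwa [quad_add_smul] at this
    -- `a₀ + s b₀ ≥ 0` with `b₀ < 0` gives `s ≤ -a₀/b₀`
    rw [le_div_iff_of_neg hx₀]
    linarith
  set sstar := sSup T with hs
  -- `sstar > 0`: a uniform `ε > 0` keeps all blocks positive semidefinite
  obtain ⟨ε, hεpos, hε⟩ := exists_uniform_eps hΛ hΔ
  have hεT : ε ∈ T := ⟨hεpos.le, fun ρ => (hε ρ).1⟩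
  have hspos : 0 < sstar := lt_of_lt_of_le hεpos (le_csSup hbdd hεT)
  -- `sstar ∈ T`
  have hsT : ∀ ρ, (Λ ρ + sstar • Δ ρ).PosSemidef := by
    intro ρ
    refine PosSemidef.of_dotProduct_mulVec_nonneg
      (isHermitian_add_smul (hΛ ρ).isHermitian (hΔ ρ) sstar) fun x => ?_
    rw [quad_add_smul]
    set a : ℝ := star x ⬝ᵥ (Λ ρ *ᵥ x) with ha
    set b : ℝ := star x ⬝ᵥ (Δ ρ *ᵥ x) with hb
    have hann : 0 ≤ a := (hΛ ρ).posSemidef.dotProduct_mulVec_nonneg x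
    by_cases hbnn : 0 ≤ b
    · exact add_nonneg hann (mul_nonneg hspos.le hbnn)
    · rw [not_le] at hbnn
      by_contra hneg
      rw [not_le] at hneg
      -- `a + sstar b < 0` means `sstar > -a/b`; pick `s ∈ T` beyond `-a/b`
      have hlt : -a / b < sstar := by
        rw [div_lt_iff_of_neg hbnn]
        linarith
      obtain ⟨s, hsmem, hslt⟩ := exists_lt_of_lt_csSup hTne hlt
      have hq : 0 ≤ a + s * b := by
        have := (hsmem.2 ρ).dotProduct_mulVec_nonneg x
        rwa [quad_add_smul] at this
      rw [div_lt_iff_of_neg hbnn] at hslt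
      linarith
  -- some block is singular at `sstar`; otherwise we could move further
  have hsing : ∃ ρ₁, ¬ (Λ ρ₁ + sstar • Δ ρ₁).PosDef := by
    by_contra hall
    push Not at hall
    obtain ⟨ε', hε'pos, hε'⟩ := exists_uniform_eps hall hΔ
    have hmem : sstar + ε' ∈ T := by
      refine ⟨by linarith, fun ρ => ?_⟩
      have h := (hε' ρ).1
      rwa [add_smul, ← add_assoc] at ⊢
    have := le_csSup hbdd hmem
    linarith
  exact ⟨sstar, hspos, hsT, hsing⟩

/-! ## §3 A singular positive semidefinite matrix has deficient rank -/

/-- A positive semidefinite `r × r` real matrix which is NOT positive definite has rank `< r`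
(its quadratic form vanishes at some `x ≠ 0`, hence `M x = 0`). [folklore] -/
private theorem rank_lt_of_posSemidef_of_not_posDef {r : ℕ} {M : Matrix (Fin r) (Fin r) ℝ} (hM : M.PosSemidef)
    (hnot : ¬ M.PosDef) : M.rank < r := by
  -- a nonzero kernel vector
  have hx : ∃ x : Fin r → ℝ, x ≠ 0 ∧ M *ᵥ x = 0 := by
    by_contra hcon
    push Not at hcon
    refine hnot (PosDef.of_dotProduct_mulVec_pos hM.1 fun x hx0 => ?_)
    have hnn := hM.dotProduct_mulVec_nonneg x
    rcases hnn.eq_or_lt with h | h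
    · exact absurd ((hM.dotProduct_mulVec_zero_iff x).mp h.symm) (hcon x hx0)
    · exact h
  obtain ⟨x, hx0, hMx⟩ := hx
  have hker : LinearMap.ker M.mulVecLin ≠ ⊥ := by
    rw [Submodule.ne_bot_iff]
    exact ⟨x, by simpa using hMx, hx0⟩
  have h1 : 1 ≤ Module.finrank ℝ (LinearMap.ker M.mulVecLin) :=
    Submodule.one_le_finrank_iff.mpr hker
  have hsum := M.mulVecLin.finrank_range_add_finrank_ker
  rw [Module.finrank_fintype_fun_eq_card, Fintype.card_fin] at hsum
  have hrank : M.rank = Module.finrank ℝ (LinearMap.range M.mulVecLin) := rfl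
  omega

/-! ## §4 The rank reduction step and the existence of a low-rank feasible point -/

/-- **Rank reduction step.** If `S` is feasible for the block standard-form constraints and its ranks exceed
the Pataki budget, `|κ| < Σ_ρ t(rank S_ρ)`, then there is a feasible `S'` — with the SAME right-hand sides,
i.e. the same value of every listed linear functional — of strictly smaller total rank,
`Σ_ρ rank S'_ρ < Σ_ρ rank S_ρ`. [cite: Pataki1998, §2 proof of Thm. 2.1, eqs. (2.3)–(2.6)]
[cite: BurerMonteiro2003, §3 Thm. 1 (p. 333)] -/
theorem exists_mem_sum_rank_lt_of_card_lt_sum_tri [Fintype κ] [∀ ρ, DecidableEq (nρ ρ)]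
    {A : κ → ∀ ρ, Matrix (nρ ρ) (nρ ρ) ℝ} {c : κ → ℝ} {S : ∀ ρ, Matrix (nρ ρ) (nρ ρ) ℝ}
    (hS : S ∈ blockFeasible A c) (hlt : Fintype.card κ < ∑ ρ, tri ((S ρ).rank)) :
    ∃ S' ∈ blockFeasible A c, ∑ ρ, (S' ρ).rank < ∑ ρ, (S ρ).rank := by
  -- §1 of Pataki's proof: factorise every block
  have hfac := fun ρ => exists_rank_factorization (hS.1 ρ)
  choose r V d hrank hdpos hVV hSeq using hfac
  have hΛ : ∀ ρ, (diagonal (d ρ)).PosDef := fun ρ => Matrix.posDef_diagonal_iff.mpr (hdpos ρ)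
  -- §2: a nonzero symmetric kernel direction, by counting dimensions
  have hdim : Module.finrank ℝ (κ → ℝ) < Module.finrank ℝ (∀ ρ, UpperPair (r ρ) → ℝ) := by
    rw [Module.finrank_fintype_fun_eq_card, Module.finrank_pi_fintype ℝ]
    simp only [Module.finrank_fintype_fun_eq_card, card_upperPair]
    calc Fintype.card κ < ∑ ρ, tri ((S ρ).rank) := hlt
      _ = ∑ ρ, tri (r ρ) := Finset.sum_congr rfl fun ρ _ => by rw [hrank ρ]
  have hker := LinearMap.ker_ne_bot_of_finrank_lt (f := blockConstraintMap A V) hdim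
  obtain ⟨e, he, hene⟩ := (Submodule.ne_bot_iff _).mp hker
  rw [LinearMap.mem_ker] at he
  -- the symmetric directions `Δ_ρ = symOf(e_ρ)` and their negatives
  have hkerΔ : ∀ i, ∑ ρ, (A i ρ * (V ρ * symOf (e ρ) * (V ρ)ᵀ)).trace = 0 := fun i => congr_fun he i
  have hkerΔ' : ∀ i, ∑ ρ, (A i ρ * (V ρ * (-symOf (e ρ)) * (V ρ)ᵀ)).trace = 0 := by
    intro i
    have h := hkerΔ i
    have h1 : ∀ ρ, (A i ρ * (V ρ * (-symOf (e ρ)) * (V ρ)ᵀ)).trace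
        = -(A i ρ * (V ρ * symOf (e ρ) * (V ρ)ᵀ)).trace := by
      intro ρ; rw [Matrix.mul_neg, Matrix.neg_mul, Matrix.mul_neg, trace_neg]
    simp only [h1, Finset.sum_neg_distrib, h, neg_zero]
  have hΔh : ∀ ρ, (symOf (e ρ)).IsHermitian := fun ρ => isHermitian_symOf (e ρ)
  have hΔh' : ∀ ρ, (-symOf (e ρ)).IsHermitian := fun ρ => (hΔh ρ).neg
  -- `Δ ≠ 0`: some block is nonzero
  obtain ⟨ρ₀, hρ₀⟩ : ∃ ρ₀, symOf (e ρ₀) ≠ 0 := by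
    by_contra hcon
    push Not at hcon
    apply hene
    funext ρ
    have h0 : symOf (0 : UpperPair (r ρ) → ℝ) = 0 := by rw [← symOfLin_apply, map_zero]
    exact symOf_injective (r ρ) ((hcon ρ).trans h0.symm)
  -- not both `Δ` and `-Δ` can be positive semidefinite in every block
  have hnotboth : ¬ (∀ ρ, (symOf (e ρ)).PosSemidef) ∨ ¬ (∀ ρ, (-symOf (e ρ)).PosSemidef) := by
    by_contra hcon
    push Not at hcon
    obtain ⟨hp, hn⟩ := hcon
    apply hρ₀
    -- `Δ_ρ₀ ⪰ 0` and `-Δ_ρ₀ ⪰ 0` force `Δ_ρ₀ x = 0` for all `x`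
    refine ext_iff_mulVec.mpr fun x => ?_
    have h1 := (hp ρ₀).dotProduct_mulVec_nonneg x
    have h2 := (hn ρ₀).dotProduct_mulVec_nonneg x
    rw [neg_mulVec, dotProduct_neg] at h2
    have h0 : star x ⬝ᵥ (symOf (e ρ₀) *ᵥ x) = 0 := le_antisymm (by linarith) h1
    rw [(hp ρ₀).dotProduct_mulVec_zero_iff x] at h0
    rw [h0, zero_mulVec]
  -- the boundary step along `Δ` or `-Δ`
  have key : ∀ (Δ : ∀ ρ, Matrix (Fin (r ρ)) (Fin (r ρ)) ℝ), (∀ ρ, (Δ ρ).IsHermitian) →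
      (∀ i, ∑ ρ, (A i ρ * (V ρ * Δ ρ * (V ρ)ᵀ)).trace = 0) → (¬ ∀ ρ, (Δ ρ).PosSemidef) →
      ∃ S' ∈ blockFeasible A c, ∑ ρ, (S' ρ).rank < ∑ ρ, (S ρ).rank := by
    intro Δ hΔ hk hnot
    obtain ⟨s, _, hpsd, ρ₁, hρ₁⟩ := exists_boundary_step hΛ hΔ hnot
    refine ⟨fun ρ => V ρ * (diagonal (d ρ) + s • Δ ρ) * (V ρ)ᵀ, line_mem hS hSeq hk hpsd, ?_⟩
    -- every block has rank `≤ r_ρ`, block `ρ₁` has rank `< r_ρ₁`, and `rank S_ρ = r_ρ`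
    have hle : ∀ ρ, (V ρ * (diagonal (d ρ) + s • Δ ρ) * (V ρ)ᵀ).rank ≤ (diagonal (d ρ) + s • Δ ρ).rank :=
      fun ρ => (rank_mul_le_left _ _).trans (rank_mul_le_right _ _)
    have hle' : ∀ ρ, (diagonal (d ρ) + s • Δ ρ).rank ≤ r ρ := fun ρ => by
      simpa using rank_le_card_width (diagonal (d ρ) + s • Δ ρ)
    have hlt₁ : (diagonal (d ρ₁) + s • Δ ρ₁).rank < r ρ₁ :=
      rank_lt_of_posSemidef_of_not_posDef (hpsd ρ₁) hρ₁
    calc ∑ ρ, (V ρ * (diagonal (d ρ) + s • Δ ρ) * (V ρ)ᵀ).rank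
        < ∑ ρ, r ρ := Finset.sum_lt_sum (fun ρ _ => (hle ρ).trans (hle' ρ))
            ⟨ρ₁, Finset.mem_univ _, (hle ρ₁).trans_lt hlt₁⟩
      _ = ∑ ρ, (S ρ).rank := Finset.sum_congr rfl fun ρ _ => (hrank ρ).symm
  rcases hnotboth with h | h
  · exact key (fun ρ => symOf (e ρ)) hΔh hkerΔ h
  · exact key (fun ρ => -symOf (e ρ)) hΔh' hkerΔ' h

/-- **Every nonempty block spectrahedron contains a point within the Pataki budget**: if
`{S : S_ρ ⪰ 0, Σ_ρ tr(A_iρ S_ρ) = c_i ∀ i ∈ κ}` is nonempty it contains `S` with `Σ_ρ t(rank S_ρ) ≤ |κ|`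
(iterate the rank reduction step; the total rank decreases each time). With the objective listed among the
rows this is "an optimal solution with `Σ t(r) ≤ m + 1` can be reached by purification".
[cite: Pataki1998, §2 Thm. 2.2 and proof of Thm. 2.1] [cite: BurerMonteiro2003, §3 Thm. 1 (p. 333)] -/
theorem exists_mem_sum_tri_rank_le_card [Fintype κ] [∀ ρ, DecidableEq (nρ ρ)]
    {A : κ → ∀ ρ, Matrix (nρ ρ) (nρ ρ) ℝ} {c : κ → ℝ} {S₀ : ∀ ρ, Matrix (nρ ρ) (nρ ρ) ℝ}
    (hS₀ : S₀ ∈ blockFeasible A c) :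
    ∃ S ∈ blockFeasible A c, ∑ ρ, tri ((S ρ).rank) ≤ Fintype.card κ := by
  -- strong induction on the total rank
  suffices h : ∀ (N : ℕ) (S : ∀ ρ, Matrix (nρ ρ) (nρ ρ) ℝ), S ∈ blockFeasible A c →
      ∑ ρ, (S ρ).rank ≤ N → ∃ S' ∈ blockFeasible A c, ∑ ρ, tri ((S' ρ).rank) ≤ Fintype.card κ from
    h _ S₀ hS₀ le_rfl
  intro N
  induction N with
  | zero =>
    intro S hS hN
    refine ⟨S, hS, ?_⟩
    have h0 : ∀ ρ, (S ρ).rank = 0 := fun ρ =>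
      Nat.eq_zero_of_le_zero ((Finset.single_le_sum (fun ρ _ => Nat.zero_le _) (Finset.mem_univ ρ)).trans hN)
    simp [h0, tri]
  | succ N ih =>
    intro S hS hN
    by_cases hle : ∑ ρ, tri ((S ρ).rank) ≤ Fintype.card κ
    · exact ⟨S, hS, hle⟩
    · rw [not_le] at hle
      obtain ⟨S', hS', hlt⟩ := exists_mem_sum_rank_lt_of_card_lt_sum_tri hS hle
      exact ih S' hS' (by omega)

/-- The same with `t` unfolded and `κ = Fin f`: a nonempty block spectrahedron with `f` scalar equality
constraints contains a point with `Σ_ρ rank(S_ρ)(rank(S_ρ)+1)/2 ≤ f`.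
[cite: Pataki1998, §2 Thm. 2.2 and proof of Thm. 2.1] -/
theorem exists_mem_sum_rank_mul_succ_div_two_le [∀ ρ, DecidableEq (nρ ρ)] {f : ℕ}
    {A : Fin f → ∀ ρ, Matrix (nρ ρ) (nρ ρ) ℝ} {c : Fin f → ℝ} {S₀ : ∀ ρ, Matrix (nρ ρ) (nρ ρ) ℝ}
    (hS₀ : S₀ ∈ blockFeasible A c) :
    ∃ S ∈ blockFeasible A c, ∑ ρ, (S ρ).rank * ((S ρ).rank + 1) / 2 ≤ f := by
  obtain ⟨S, hS, h⟩ := exists_mem_sum_tri_rank_le_card hS₀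
  exact ⟨S, hS, by simpa [tri, Fintype.card_fin] using h⟩

end Literature.Computation.Certificates.SDPRankReduction
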